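import Summits.NavierStokesRegularity.NavierStokesRegularity.Theorems.ExtremiserTransienceNearExtremalTransienceExtremiserLiouvilleConstantSpeedSlabEnergySandwich
import HarnessLib

/-!
# Crux `ExtremiserTransience.NearExtremalTransience` (stmt-NavierStokesRegularity-21883), line `extremiser_liouville`,
# stub K1b — THE JET'S BLOW-DOWN IS HORIZONTAL: the axial part of every degree-`(−1)` pairing vanishes

`--supports stmt-NavierStokesRegularity-21883` (helper).  Author: prover seat `ns-el-k1b` (g5).  Continues
`…ConstantSpeedSlabEnergySandwich` (jet: `∫_{s+1≤ξ≤s+N}‖V‖² ≤ N·E₀`) towards the use of the Stokeslet law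
(`…ConstantSpeedBlowDownPairing/Stokeslet`: `κ⋆²M²W·R⁻²∫⟪v − c, (ΔΨ)(x/R)⟫dx → ⟪Ψ(0), b⟫`).

Setting (axial frame): `V = w − c ∈ C¹` divergence free, `⟪V, c⟫ = −‖V‖²/2`, `c = (0,0,c₂) ≠ 0`, `‖V‖²` slab-integrable for every
slab, window energies `≡ E₀` on `[0,1]` (the JET data of `…EnergyFluxJet`).

* `integral_indicator_absSlab_le_of_jet` : `∫_{|x₂| ≤ N}‖V‖² ≤ (2N+1)·E₀` for every `N ∈ ℕ` — the `L²`-mass of the jet in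
  balls grows at most LINEARLY: the degree-`(−1)` blow-down `V_R = R·V(R·)` is bounded in `L²_loc`;
* `abs_integral_axial_mul_rescale_le` : for `G` bounded by `C` and supported in `closedBall 0 ρ`:
  `|∫ V₂(x)·G₂(R⁻¹x) dx| ≤ (C/(2|c₂|))·(2⌈ρR⌉ + 1)·E₀` (`|V₂| = ‖V‖²/(2|c₂|)` pointwise: the axial component is QUADRATIC);
* `tendsto_axial_pairing_rescale` : **`R⁻²∫ V₂(x)·G₂(R⁻¹x) dx → 0`** as `R → ∞` for every continuous compactly supported `G`;
* `tendsto_horizontal_pairing_of_tendsto` : hence if `K·R⁻²∫⟪V(x), G(R⁻¹x)⟫dx → L` (e.g. the Stokeslet law with `G = ΔΨ`,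
  `L = ⟪Ψ(0), b⟫`) then the HORIZONTAL pairing alone converges to `L`:
  `K·R⁻²∫(⟪V(x), G(R⁻¹x)⟫ − V₂(x)G₂(R⁻¹x))dx → L`.

READING (record §6): every distributional blow-down limit of the residue JET is horizontal (`⟪V_∞, c⟫ = 0`) and `L²_loc`; with
the Stokeslet law it is the Stokeslet of force `b/(κ⋆²M²W)`, and a horizontal Stokeslet vanishes — whence `b = 0` for jets
(the Stokes–Liouville step is for the next seat).

WHAT THIS IS NOT: K1b is NOT proved; nothing here proves NS regularity. [folklore]
-/

noncomputable section

open Set Filter Topology MeasureTheory Metric Function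
open scoped ENNReal NNReal Topology InnerProductSpace RealInnerProductSpace ContDiff
open Literature.Analysis.FluidPDE Literature.Analysis

namespace Summit.NavierStokesRegularity.NavierStokesRegularity.Theorems

-- the problem directory repeats the summit name (`NavierStokesRegularity/NavierStokesRegularity`)
set_option linter.dupNamespace false

namespace ExtremiserLiouville

variable {V : EuclideanSpace ℝ (Fin 3) → EuclideanSpace ℝ (Fin 3)} {c : EuclideanSpace ℝ (Fin 3)}

/-! ## Linear growth of the jet's `L²`-mass in symmetric slabs -/

/-- **`∫_{|x₂| ≤ N}‖V‖² ≤ (2N+1)·E₀`** for the residue jet (`N ∈ ℕ`). [folklore] -/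
theorem integral_indicator_absSlab_le_of_jet (hV : ContDiff ℝ 1 V) (hdiv : VectorCalculus.IsDivFree V)
    (hVc : ∀ x, ⟪V x, c⟫ = -(‖V x‖ ^ 2 / 2)) (hc0 : c 0 = 0) (hc1 : c 1 = 0) (hc2 : c 2 ≠ 0)
    (hL2 : ∀ T : ℝ, Integrable (fun x => {x : EuclideanSpace ℝ (Fin 3) | |x 2| ≤ T}.indicator (fun x => ‖V x‖ ^ 2) x)
      volume)
    {E₀ : ℝ} (hE : ∀ u ∈ Icc (0 : ℝ) 1, (∫ x : EuclideanSpace ℝ (Fin 3),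
      deriv Real.smoothTransition (x 2 - u) * ‖V x‖ ^ 2) = E₀) (N : ℕ) :
    (∫ x, {x : EuclideanSpace ℝ (Fin 3) | |x 2| ≤ N}.indicator (fun x => ‖V x‖ ^ 2) x) ≤ (2 * N + 1) * E₀ := by
  have hs : |(-(N : ℝ) - 1)| + ((2 * N + 1 : ℕ) : ℝ) + 2 ≤ 3 * N + 4 := by
    rw [show (-(N : ℝ) - 1) = -((N : ℝ) + 1) by ring, abs_neg, abs_of_nonneg (by positivity)]
    push_cast; linarith
  have h := (slabEnergy_sandwich_of_windowEnergy hV hdiv hVc hc0 hc1 hc2 hs (hL2 _) hE).1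
  have e : {x : EuclideanSpace ℝ (Fin 3) | -(N : ℝ) - 1 + 1 ≤ x 2 ∧ x 2 ≤ -(N : ℝ) - 1 + ((2 * N + 1 : ℕ) : ℝ)} =
      {x : EuclideanSpace ℝ (Fin 3) | |x 2| ≤ N} := by
    ext x
    simp only [mem_setOf_eq, abs_le]
    push_cast
    constructor
    · rintro ⟨h1, h2⟩; exact ⟨by linarith, by linarith⟩
    · rintro ⟨h1, h2⟩; exact ⟨by linarith, by linarith⟩
  rw [e] at h
  calc (∫ x, {x : EuclideanSpace ℝ (Fin 3) | |x 2| ≤ N}.indicator (fun x => ‖V x‖ ^ 2) x)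
      ≤ ((2 * N + 1 : ℕ) : ℝ) * E₀ := h
    _ = (2 * N + 1) * E₀ := by push_cast; ring

/-! ## The axial component is quadratic: `|V₂| = ‖V‖²/(2|c₂|)` -/

/-- `|V x 2| * |c 2| = ‖V x‖²/2` when `⟪V, c⟫ = −‖V‖²/2` and `c = (0,0,c₂)`. [folklore] -/
theorem abs_axial_mul_eq (hVc : ∀ x, ⟪V x, c⟫ = -(‖V x‖ ^ 2 / 2)) (hc0 : c 0 = 0) (hc1 : c 1 = 0)
    (x : EuclideanSpace ℝ (Fin 3)) : |V x 2| * |c 2| = ‖V x‖ ^ 2 / 2 := by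
  have h := hVc x
  have e : ⟪V x, c⟫ = V x 2 * c 2 := by
    simp only [PiLp.inner_apply, RCLike.inner_apply, conj_trivial, Fin.sum_univ_three, hc0, hc1]
    ring
  rw [e] at h
  rw [← abs_mul, h, abs_neg, abs_of_nonneg (by positivity)]

/-! ## The axial pairing vanishes in the blow-down -/

/-- **Axial pairing bound.**  For `G` with `‖G y‖ ≤ C` and `G y = 0` for `‖y‖ > ρ`, and `R ≥ 1`:
`|∫ V₂(x) G₂(R⁻¹x) dx| ≤ (C/(2|c₂|))·(2⌈ρR⌉₊ + 1)·E₀`. [folklore] -/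
theorem abs_integral_axial_mul_rescale_le (hV : ContDiff ℝ 1 V) (hdiv : VectorCalculus.IsDivFree V)
    (hVc : ∀ x, ⟪V x, c⟫ = -(‖V x‖ ^ 2 / 2)) (hc0 : c 0 = 0) (hc1 : c 1 = 0) (hc2 : c 2 ≠ 0)
    (hL2 : ∀ T : ℝ, Integrable (fun x => {x : EuclideanSpace ℝ (Fin 3) | |x 2| ≤ T}.indicator (fun x => ‖V x‖ ^ 2) x)
      volume)
    {E₀ : ℝ} (hE : ∀ u ∈ Icc (0 : ℝ) 1, (∫ x : EuclideanSpace ℝ (Fin 3),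
      deriv Real.smoothTransition (x 2 - u) * ‖V x‖ ^ 2) = E₀)
    {G : EuclideanSpace ℝ (Fin 3) → EuclideanSpace ℝ (Fin 3)} {C ρ : ℝ} (hC : ∀ y, ‖G y‖ ≤ C)
    (hGρ : ∀ y, ρ < ‖y‖ → G y = 0) {R : ℝ} (hR : 1 ≤ R) :
    |∫ x, V x 2 * G (R⁻¹ • x) 2| ≤ C / (2 * |c 2|) * ((2 * (⌈ρ * R⌉₊ : ℕ) + 1) * E₀) := by
  have hRpos : 0 < R := lt_of_lt_of_le one_pos hR
  have hc2' : 0 < |c 2| := abs_pos.2 hc2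
  have hC0 : 0 ≤ C := (norm_nonneg _).trans (hC 0)
  set N : ℕ := ⌈ρ * R⌉₊ with hN
  set SL : Set (EuclideanSpace ℝ (Fin 3)) := {x | |x 2| ≤ N} with hSL
  -- pointwise domination by the symmetric slab density
  have hptw : ∀ x, |V x 2 * G (R⁻¹ • x) 2| ≤ C / (2 * |c 2|) * SL.indicator (fun x => ‖V x‖ ^ 2) x := by
    intro x
    by_cases hx : ρ < ‖R⁻¹ • x‖
    · rw [hGρ _ hx]
      simp only [PiLp.zero_apply, mul_zero, abs_zero]
      exact mul_nonneg (by positivity) (indicator_nonneg (fun _ _ => sq_nonneg _) _)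
    · have hxSL : x ∈ SL := by
        show |x 2| ≤ N
        rw [not_lt, norm_smul, Real.norm_eq_abs, abs_of_pos (inv_pos.2 hRpos)] at hx
        have h1 : ‖x‖ ≤ ρ * R := by
          have h' := mul_le_mul_of_nonneg_right hx hRpos.le
          rwa [mul_comm R⁻¹ ‖x‖, inv_mul_cancel_right₀ hRpos.ne'] at h'
        have h2 : |x 2| ≤ ‖x‖ := by
          rw [← Real.norm_eq_abs]; exact PiLp.norm_apply_le x 2
        exact h2.trans (h1.trans (Nat.le_ceil _))
      rw [indicator_of_mem hxSL, abs_mul]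
      have hG2 : |G (R⁻¹ • x) 2| ≤ C := by
        rw [← Real.norm_eq_abs]; exact (PiLp.norm_apply_le (G (R⁻¹ • x)) 2).trans (hC _)
      have hV2 : |V x 2| = ‖V x‖ ^ 2 / 2 / |c 2| := by
        rw [eq_div_iff hc2'.ne']; exact abs_axial_mul_eq hVc hc0 hc1 x
      rw [hV2]
      calc ‖V x‖ ^ 2 / 2 / |c 2| * |G (R⁻¹ • x) 2| ≤ ‖V x‖ ^ 2 / 2 / |c 2| * C :=
            mul_le_mul_of_nonneg_left hG2 (by positivity)
        _ = C / (2 * |c 2|) * ‖V x‖ ^ 2 := by field_simp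
  have hint : Integrable (fun x => C / (2 * |c 2|) * SL.indicator (fun x => ‖V x‖ ^ 2) x) volume :=
    (hL2 N).const_mul _
  calc |∫ x, V x 2 * G (R⁻¹ • x) 2| ≤ ∫ x, |V x 2 * G (R⁻¹ • x) 2| := abs_integral_le_integral_abs
    _ ≤ ∫ x, C / (2 * |c 2|) * SL.indicator (fun x => ‖V x‖ ^ 2) x :=
        integral_mono_of_nonneg (Eventually.of_forall fun x => abs_nonneg _) hint (Eventually.of_forall hptw)
    _ = C / (2 * |c 2|) * ∫ x, SL.indicator (fun x => ‖V x‖ ^ 2) x := integral_const_mul _ _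
    _ ≤ C / (2 * |c 2|) * ((2 * (N : ℝ) + 1) * E₀) :=
        mul_le_mul_of_nonneg_left (integral_indicator_absSlab_le_of_jet hV hdiv hVc hc0 hc1 hc2 hL2 hE N)
          (by positivity)

/-- **The axial pairing vanishes in the blow-down**: `R⁻²∫ V₂(x) G₂(R⁻¹x) dx → 0` for every continuous compactly supported
`G` (so only the HORIZONTAL components of the jet pair with degree-`(−1)` test structures). [folklore] -/
theorem tendsto_axial_pairing_rescale (hV : ContDiff ℝ 1 V) (hdiv : VectorCalculus.IsDivFree V)
    (hVc : ∀ x, ⟪V x, c⟫ = -(‖V x‖ ^ 2 / 2)) (hc0 : c 0 = 0) (hc1 : c 1 = 0) (hc2 : c 2 ≠ 0)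
    (hL2 : ∀ T : ℝ, Integrable (fun x => {x : EuclideanSpace ℝ (Fin 3) | |x 2| ≤ T}.indicator (fun x => ‖V x‖ ^ 2) x)
      volume)
    {E₀ : ℝ} (hE : ∀ u ∈ Icc (0 : ℝ) 1, (∫ x : EuclideanSpace ℝ (Fin 3),
      deriv Real.smoothTransition (x 2 - u) * ‖V x‖ ^ 2) = E₀)
    {G : EuclideanSpace ℝ (Fin 3) → EuclideanSpace ℝ (Fin 3)} (hG : Continuous G) (hGc : HasCompactSupport G) :
    Tendsto (fun R : ℝ => R⁻¹ * R⁻¹ * ∫ x, V x 2 * G (R⁻¹ • x) 2) atTop (𝓝 0) := by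
  obtain ⟨C, hC⟩ := hG.bounded_above_of_compact_support hGc
  obtain ⟨ρ₀, hρ₀⟩ := (Metric.isBounded_iff_subset_closedBall (0 : EuclideanSpace ℝ (Fin 3))).1 hGc.isBounded
  set ρ : ℝ := max ρ₀ 0 with hρ
  have hρ0 : 0 ≤ ρ := le_max_right _ _
  have hGρ : ∀ y, ρ < ‖y‖ → G y = 0 := by
    intro y hy
    have : y ∉ tsupport G := fun h => by
      have := hρ₀ h
      rw [mem_closedBall, dist_zero_right] at this
      linarith [le_max_left ρ₀ 0]
    exact image_eq_zero_of_notMem_tsupport this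
  have hE0 : 0 ≤ E₀ := by
    have h := hE 0 (left_mem_Icc.2 zero_le_one)
    rw [← h]
    exact integral_nonneg fun x => mul_nonneg (Real.smoothTransition.monotone.deriv_nonneg) (sq_nonneg _)
  have hc2' : 0 < |c 2| := abs_pos.2 hc2
  have hC0 : 0 ≤ C := (norm_nonneg _).trans (hC 0)
  -- `|R⁻² ∫…| ≤ R⁻² · K · (2(ρR + 1) + 1) E₀ → 0`
  set K : ℝ := C / (2 * |c 2|) with hK
  have hK0 : 0 ≤ K := by positivity
  have hbound : ∀ R : ℝ, 1 ≤ R → |R⁻¹ * R⁻¹ * ∫ x, V x 2 * G (R⁻¹ • x) 2| ≤ K * ((2 * ρ + 3) * E₀) * R⁻¹ := by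
    intro R hR
    have hRpos : 0 < R := lt_of_lt_of_le one_pos hR
    have h := abs_integral_axial_mul_rescale_le hV hdiv hVc hc0 hc1 hc2 hL2 hE hC hGρ hR
    have hceil : ((⌈ρ * R⌉₊ : ℕ) : ℝ) ≤ ρ * R + 1 := by
      have := Nat.ceil_lt_add_one (by positivity : 0 ≤ ρ * R)
      exact this.le
    rw [abs_mul, abs_of_nonneg (by positivity : (0 : ℝ) ≤ R⁻¹ * R⁻¹)]
    calc R⁻¹ * R⁻¹ * |∫ x, V x 2 * G (R⁻¹ • x) 2| ≤ R⁻¹ * R⁻¹ * (K * ((2 * ((⌈ρ * R⌉₊ : ℕ) : ℝ) + 1) * E₀)) :=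
          mul_le_mul_of_nonneg_left h (by positivity)
      _ ≤ R⁻¹ * R⁻¹ * (K * ((2 * (ρ * R + 1) + 1) * E₀)) := by
          gcongr
      _ ≤ K * ((2 * ρ + 3) * E₀) * R⁻¹ := by
          rw [show R⁻¹ * R⁻¹ * (K * ((2 * (ρ * R + 1) + 1) * E₀)) =
            K * E₀ * (2 * ρ * (R * R⁻¹) * R⁻¹ + 3 * (R⁻¹ * R⁻¹)) by ring, mul_inv_cancel₀ hRpos.ne']
          have hRinv1 : R⁻¹ ≤ 1 := inv_le_one_of_one_le₀ hR
          have hRinv0 : 0 ≤ R⁻¹ := by positivity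
          nlinarith [mul_le_mul_of_nonneg_left hRinv1 hRinv0, hK0, hE0, hρ0, mul_nonneg hK0 hE0]
  have hlim : Tendsto (fun R : ℝ => K * ((2 * ρ + 3) * E₀) * R⁻¹) atTop (𝓝 0) := by
    have := tendsto_inv_atTop_zero.const_mul (K * ((2 * ρ + 3) * E₀))
    rwa [mul_zero] at this
  refine squeeze_zero_norm' ?_ hlim
  filter_upwards [eventually_ge_atTop (1 : ℝ)] with R hR
  rw [Real.norm_eq_abs]
  exact hbound R hR

/-- **Only the horizontal pairing matters.**  If `K·R⁻²∫⟪V(x), G(R⁻¹x)⟫dx → L` (e.g. the Stokeslet law with `G = ΔΨ`), then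
`K·R⁻²∫(⟪V(x), G(R⁻¹x)⟫ − V₂(x)G₂(R⁻¹x))dx → L`: the blow-down limit of the jet is HORIZONTAL. [folklore] -/
theorem tendsto_horizontal_pairing_of_tendsto (hV : ContDiff ℝ 1 V) (hdiv : VectorCalculus.IsDivFree V)
    (hVc : ∀ x, ⟪V x, c⟫ = -(‖V x‖ ^ 2 / 2)) (hc0 : c 0 = 0) (hc1 : c 1 = 0) (hc2 : c 2 ≠ 0)
    (hL2 : ∀ T : ℝ, Integrable (fun x => {x : EuclideanSpace ℝ (Fin 3) | |x 2| ≤ T}.indicator (fun x => ‖V x‖ ^ 2) x)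
      volume)
    {E₀ : ℝ} (hE : ∀ u ∈ Icc (0 : ℝ) 1, (∫ x : EuclideanSpace ℝ (Fin 3),
      deriv Real.smoothTransition (x 2 - u) * ‖V x‖ ^ 2) = E₀)
    {G : EuclideanSpace ℝ (Fin 3) → EuclideanSpace ℝ (Fin 3)} (hG : Continuous G) (hGc : HasCompactSupport G)
    {K L : ℝ} (hlim : Tendsto (fun R : ℝ => K * (R⁻¹ * R⁻¹ * ∫ x, ⟪V x, G (R⁻¹ • x)⟫)) atTop (𝓝 L)) :
    Tendsto (fun R : ℝ => K * (R⁻¹ * R⁻¹ * ∫ x, (⟪V x, G (R⁻¹ • x)⟫ - V x 2 * G (R⁻¹ • x) 2))) atTop (𝓝 L) := by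
  have hax := (tendsto_axial_pairing_rescale hV hdiv hVc hc0 hc1 hc2 hL2 hE hG hGc).const_mul K
  rw [mul_zero] at hax
  have h := hlim.sub hax
  rw [sub_zero] at h
  refine h.congr' ((eventually_gt_atTop 0).mono fun R hR => ?_)
  -- integrability of the two densities (continuous with compact support)
  have hGR : Continuous fun x : EuclideanSpace ℝ (Fin 3) => G (R⁻¹ • x) := hG.comp (continuous_id.const_smul R⁻¹)
  have hGRc : HasCompactSupport fun x : EuclideanSpace ℝ (Fin 3) => G (R⁻¹ • x) := hGc.comp_smul (inv_ne_zero hR.ne')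
  have i1 : Integrable (fun x => ⟪V x, G (R⁻¹ • x)⟫) volume := by
    refine (hV.continuous.inner hGR).integrable_of_hasCompactSupport (hGRc.mono fun x hx => ?_)
    rw [mem_support] at hx ⊢
    contrapose! hx
    rw [hx, inner_zero_right]
  have i2 : Integrable (fun x => V x 2 * G (R⁻¹ • x) 2) volume := by
    refine (((PiLp.continuous_apply 2 _ (2 : Fin 3)).comp hV.continuous).mul
      ((PiLp.continuous_apply 2 _ (2 : Fin 3)).comp hGR)).integrable_of_hasCompactSupport (hGRc.mono fun x hx => ?_)
    rw [mem_support] at hx ⊢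
    contrapose! hx
    show V x 2 * G (R⁻¹ • x) 2 = 0
    rw [hx, PiLp.zero_apply, mul_zero]
  show K * (R⁻¹ * R⁻¹ * ∫ x, ⟪V x, G (R⁻¹ • x)⟫) - K * (R⁻¹ * R⁻¹ * ∫ x, V x 2 * G (R⁻¹ • x) 2) =
    K * (R⁻¹ * R⁻¹ * ∫ x, (⟪V x, G (R⁻¹ • x)⟫ - V x 2 * G (R⁻¹ • x) 2))
  rw [integral_sub i1 i2]; ring

end ExtremiserLiouville

end Summit.NavierStokesRegularity.NavierStokesRegularity.Theorems

end
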